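import Literature.NumberTheory.EllipticCurves.TateCurve.UniformizationHolds
import Literature.NumberTheory.EllipticCurves.TateCurve.NumberField
import Literature.NumberTheory.EllipticCurves.QuadraticTwistDescentProofs
import Literature.NumberTheory.DiophantineGeometry.LocalReductionProofs
import Mathlib.Analysis.Normed.Unbundled.SpectralNorm
import HarnessLib

/-!
# Split multiplicative reduction from rational points of odd order
# (Silverman, *Advanced Topics*, Thm. V.5.3 with Cor. V.5.4 / Thm. V.3.1 (c)(d): on a NON-split
# multiplicative curve at most `n` rational points are killed by an odd `n`)

Topic `Literature/NumberTheory/EllipticCurves/TateCurve`, namespace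
`Literature.NumberTheory.EllipticCurves.TateCurve`; `Proofs`-style file (theorems only: no
definition, no named fact, no instance) of the cell `abc-iut` (seat abc-iut-L5-t12), classical.

Let `K` be a complete ultrametric field of characteristic `0`, `E/K` an elliptic curve with
`|j(E)| > 1` and `q ∈ K` its Tate parameter (`tateJ q = j(E)`, `0 < |q| < 1`; Silverman ATAEC
Lemma V.5.1 / Thm. V.5.3 (a)). By ATAEC Thm. V.5.3 (b) (the tree's `iso_tateCurve_iff_isSquare_gamma`)
`E ≅_K E_q` iff `γ(E/K) = -c₄/c₆ ∈ K^{*2}`; otherwise (Cor. V.5.4) `E` is the quadratic twist of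
`E_q` by the character of `K(√γ)/K`. We prove the consequence for torsion that the abc-iut cell
needs, WITHOUT developing the twisted uniformisation of Cor. V.5.4:

* `iso_tateCurve_of_odd_torsion` — **if `E(K)` has more than `n` points killed by an ODD `n`,
  then `E ≅_K E_q`** (so `γ(E/K) = 1` and `E` has split multiplicative reduction).
  Proof. Over `K̄` there is a change of variables `C` with `C • E = E_q` (V.5.3 (a), the tree's
  `isomorphic_tateCurve_of_one_lt_norm_j_holds`); for `σ ∈ G_K` the cocycle `C⁻¹σ(C)` lies in
  `Aut(E/K̄) = {1, [-1]}` (`j ≠ 0, 1728` as `|j| > 1`; Silverman AEC III.10.1, the tree's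
  `VariableChange.eq_one_or_eq_neg_of_smul_eq`). If it were trivial for all `σ`, Galois descent
  (`exists_variableChange_eq_of_forall_map_algEquiv_eq`) would give `E ≅_K E_q`. Otherwise pick
  `σ₀` with `σ₀(C) = C∘[-1]`; then for every `P ∈ E(K)` the point `Q = C(P) ∈ E_q(K̄)` satisfies
  `σ₀(Q) = -Q`. By Tate's uniformisation `φ : K̄^*/q^ℤ ⥲ E_q(K̄)` (ATAEC V.3.1 (c)(d), the tree's
  theorem `uniformization_holds`, `G_K`-equivariant) write `Q = φ(u)`: then `σ₀(u)·u ∈ q^ℤ` and, if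
  `n • P = O`, `uⁿ ∈ q^ℤ`. Since `|σ₀(u)| = |u|` (the spectral norm on `K̄` is Galois invariant),
  `|u|² = |q|^m`, `|u|ⁿ = |q|^k`, whence `mn = 2k`; for `n` odd `m` is even, and replacing `u` by
  `u·q^{-m/2}` (same `Q`) gives `|u| = 1`, then `uⁿ = q^{k'}` with `|q|^{k'} = 1` forces `uⁿ = 1`.
  So `P ↦ u` injects the `n`-torsion of `E(K)` into the `n`-th roots of unity of `K̄`: at most `n`
  points.
* `hasSplitMultiplicativeReduction_of_odd_torsion` — the same conclusion read as "some `K`-model is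
  a minimal equation with split multiplicative reduction" over the valuation ring `R` of `K`
  (V.5.3 (b) (i) ⇒ (iii), the tree's `splitMultiplicative_of_iso_tateCurve`).
* `hasSplitMultiplicativeReductionAt_of_iso_tateCurve` — number-field reading: `W/F` with
  `W ⊗ F_v ≅_{F_v} E_q` has `W.HasSplitMultiplicativeReductionAt v` (the CHOSEN local minimal
  model at `v` has split multiplicative reduction: all minimal models do, the tree's
  `hasSplitMultiplicativeReduction_iff_of_isMinimal_of_eq_smul`).
* `hasSplitMultiplicativeReductionAt_of_odd_torsion` — **`W/F` an elliptic curve over a number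
  field, `v` a finite place with `|j(W)|_v > 1` (potentially multiplicative reduction), and more
  than `n` points of `W(F_v)` killed by an odd `n` ⟹ `W` has SPLIT multiplicative reduction at
  `v`**; `…_of_one_lt_valuation` is the same with the hypothesis as `1 < v.valuation F W.j`.

Consumer (locator = where it is used; the mathematics is classical): [IUTchI] Def. 3.1 (b)(c) /
Example 3.2 (iv) (kurims May-2020 manuscript pp. 61–62, 71): at `v̲ ∈ V̲^bad` the curve
`E_K = E_F ×_F K` has multiplicative reduction and `E_F[l] ⊆ E_F(K)` (`l ≥ 5` prime), hence —
this file — SPLIT multiplicative reduction over `K_v̲`, which is the hypothesis `hsplit` of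
abc-iut-w5-d209's `InitialThetaData.exists_pow_two_mul_l_eq_tateParameter` ("`q_v` admits a
`2l`-th root"). Nothing of the IUT series is asserted; no side is taken on [IUTchIII] Cor. 3.12.

## References
* [SilvermanATAEC1994] J. H. Silverman, *Advanced Topics in the Arithmetic of Elliptic Curves*,
  GTM 151, Springer 1994: Thm. V.3.1 (c)(d) (PDF pp. 394–395), Lemma V.5.2, Thm. V.5.3,
  Cor. V.5.4 (PDF pp. 406–410).
* [SilvermanAEC2009] J. H. Silverman, *The Arithmetic of Elliptic Curves*, 2nd ed., GTM 106:
  III.10 Thm. 10.1 (`Aut(E) = {±1}` for `j ≠ 0, 1728`), X.2 (twisting principle),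
  VII.1 Prop. 1.3 (b), VII.5 Prop. 5.1.
-/

noncomputable section

open scoped Classical

open WeierstrassCurve Field

namespace Literature.NumberTheory.EllipticCurves.TateCurve

open SteinWuthrich2013

universe u

/-! ### The local theorem -/

section Local

variable {K : Type u} [NontriviallyNormedField K] [CompleteSpace K] [IsUltrametricDist K]
  [CharZero K]

/-- **On a non-split multiplicative curve at most `n` rational points are killed by an odd `n`;
equivalently: `E/K` with `|j(E)| > 1`, Tate parameter `q`, and MORE than `n` points of `E(K)`
killed by an ODD `n` is `K`-isomorphic to the Tate curve `E_q`** (Silverman ATAEC Thm. V.5.3 with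
Cor. V.5.4 "`E(K) ≅ {u ∈ L^* : N(u) ∈ q^ℤ}/q^ℤ`" for the non-split case; here proved directly from
V.3.1 (c)(d), V.5.3 (a)(b) and `Aut(E) = {±1}` — see the module docstring for the argument).
[cite: SilvermanATAEC1994, Thm. V.5.3 and Cor. V.5.4 (PDF pp. 407–410)] -/
theorem iso_tateCurve_of_odd_torsion (E : WeierstrassCurve K) [E.IsElliptic] {q : K}
    (hj : 1 < ‖E.j‖) (hq0 : q ≠ 0) (hq : ‖q‖ < 1) (hqj : tateJ q = E.j) {n : ℕ} (hn : Odd n)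
    (S : Finset E.toAffine.Point) (hS : ∀ P ∈ S, n • P = 0) (hcard : n < S.card) :
    ∃ C : VariableChange K, C • E = tateCurve q := by
  by_contra hiso
  haveI : IsGalois K (AlgebraicClosure K) := {}
  haveI hTq : (tateCurve q).IsElliptic := tateCurve_isElliptic hq0 hq
  haveI hEb : (E.baseChange (AlgebraicClosure K)).IsElliptic :=
    inferInstanceAs (E.map (algebraMap K (AlgebraicClosure K))).IsElliptic
  have hn0 : 0 < n := hn.pos
  obtain ⟨hj0, hj1728⟩ := j_ne_zero_and_ne_1728_of_one_lt_norm hj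
  -- (1) a `K̄`-isomorphism with the Tate curve (ATAEC V.5.3 (a))
  obtain ⟨q', hq0', hq', hqj', C, hC⟩ := isomorphic_tateCurve_of_one_lt_norm_j_holds E hj
  have hqq : q = q' := (tateParameter_unique hq0' hq' hqj' hq0 hq hqj).symm
  subst hqq
  -- (2) the cocycle `C⁻¹ σ(C)` takes values in `Aut(E/K̄) = {1, [-1]}`
  set A : VariableChange (AlgebraicClosure K) :=
    ⟨-1, 0, -(E.baseChange (AlgebraicClosure K)).a₁, -(E.baseChange (AlgebraicClosure K)).a₃⟩ with hA
  have hcoc : ∀ σ : AlgebraicClosure K ≃ₐ[K] AlgebraicClosure K,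
      C.map ((σ : AlgebraicClosure K →ₐ[K] AlgebraicClosure K) :
        AlgebraicClosure K →+* AlgebraicClosure K) = C ∨
      C.map ((σ : AlgebraicClosure K →ₐ[K] AlgebraicClosure K) :
        AlgebraicClosure K →+* AlgebraicClosure K) = C * A := by
    intro σ
    have h2 : (2 : AlgebraicClosure K) ≠ 0 := two_ne_zero
    have h3 : (3 : AlgebraicClosure K) ≠ 0 := three_ne_zero
    have hjb : (E.baseChange (AlgebraicClosure K)).j = algebraMap K (AlgebraicClosure K) E.j :=
      E.map_j _
    have hj0b : (E.baseChange (AlgebraicClosure K)).j ≠ 0 := by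
      rw [hjb]; exact (map_ne_zero _).mpr hj0
    have hj1728b : (E.baseChange (AlgebraicClosure K)).j ≠ 1728 := by
      rw [hjb, ← map_ofNat (algebraMap K (AlgebraicClosure K)) 1728]
      exact fun h => hj1728 ((algebraMap K (AlgebraicClosure K)).injective h)
    rcases VariableChange.eq_one_or_eq_neg_of_smul_eq (E.baseChange (AlgebraicClosure K)) h2 h3 hj0b
        hj1728b (VariableChange.inv_mul_map_algEquiv_smul σ hC) with h1 | hneg
    · exact Or.inl (inv_mul_eq_one.mp h1).symm
    · right
      rw [hA, ← hneg, mul_inv_cancel_left]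
  -- (3) the cocycle is not identically trivial (else Galois descent gives `E ≅_K E_q`)
  obtain ⟨σ₀, hσ₀⟩ : ∃ σ₀ : AlgebraicClosure K ≃ₐ[K] AlgebraicClosure K,
      C.map ((σ₀ : AlgebraicClosure K →ₐ[K] AlgebraicClosure K) :
        AlgebraicClosure K →+* AlgebraicClosure K) = C * A := by
    by_contra hall
    push Not at hall
    exact hiso (exists_variableChange_eq_of_forall_map_algEquiv_eq hC
      fun σ => (hcoc σ).resolve_right (hall σ))
  -- (4) transport of points `Φ : E(K) → E_q(K̄)`, `P ↦ C(P)`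
  have e0 : E.baseChange K = E := by
    change E.map (algebraMap K K) = E
    rw [Algebra.algebraMap_self]
    exact E.map_id
  let ι : E.toAffine.Point →+ (E.baseChange (AlgebraicClosure K)).toAffine.Point :=
    (Affine.Point.baseChange (W' := E.toAffine) K (AlgebraicClosure K)).comp
      (Affine.Point.congrEquiv e0.symm).toAddMonoidHom
  have hιinj : Function.Injective ι :=
    (Affine.Point.map_injective _).comp (Affine.Point.congrEquiv e0.symm).injective
  let ψ : (E.baseChange (AlgebraicClosure K)).toAffine.Point ≃+
      ((tateCurve q).baseChange (AlgebraicClosure K)).toAffine.Point :=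
    (VariableChange.pointEquiv (E.baseChange (AlgebraicClosure K)) C).trans
      (Affine.Point.congrEquiv hC)
  let Φ : E.toAffine.Point →+ ((tateCurve q).baseChange (AlgebraicClosure K)).toAffine.Point :=
    ψ.toAddMonoidHom.comp ι
  have hΦinj : Function.Injective Φ := ψ.injective.comp hιinj
  have hΦapply : ∀ P, Φ P = ψ (ι P) := fun _ => rfl
  -- `σ₀` acts by `-1` on the image of `Φ`
  have hneg : ∀ P : E.toAffine.Point,
      Affine.Point.map (σ₀ : AlgebraicClosure K →ₐ[K] AlgebraicClosure K) (Φ P) = -Φ P := by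
    intro P
    rw [← map_neg]
    rcases P with _ | ⟨x, y, hxy⟩
    · rw [← Affine.Point.zero_def, neg_zero, map_zero, map_zero]
    · rw [Affine.Point.neg_some, hΦapply, hΦapply]
      simp only [ψ, ι, AddMonoidHom.comp_apply,
        AddEquiv.coe_toAddMonoidHom, AddEquiv.trans_apply, Affine.Point.congrEquiv_some,
        Affine.Point.map_some, VariableChange.pointEquiv_some, Affine.Point.some.injEq]
      have hσx : (σ₀ : AlgebraicClosure K →ₐ[K] AlgebraicClosure K) (Algebra.ofId K _ x) =
          Algebra.ofId K _ x := σ₀.commutes x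
      have hσy : (σ₀ : AlgebraicClosure K →ₐ[K] AlgebraicClosure K) (Algebra.ofId K _ y) =
          Algebra.ofId K _ y := σ₀.commutes y
      have hAX : A.toX (Algebra.ofId K (AlgebraicClosure K) x) = Algebra.ofId K _ x := by
        simp [hA, VariableChange.toX_def]
      have hAY : A.toY (Algebra.ofId K (AlgebraicClosure K) x) (Algebra.ofId K _ y) =
          Algebra.ofId K (AlgebraicClosure K) (E.toAffine.negY x y) := by
        simp only [hA, VariableChange.toY_def, Affine.negY, map_neg, map_sub, map_mul]
        change _ = -(Algebra.ofId K (AlgebraicClosure K)) y -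
          algebraMap K (AlgebraicClosure K) E.a₁ * (Algebra.ofId K (AlgebraicClosure K)) x -
          algebraMap K (AlgebraicClosure K) E.a₃
        simp [Algebra.ofId_apply]
        ring
      constructor
      · calc (σ₀ : AlgebraicClosure K →ₐ[K] AlgebraicClosure K) (C.toX (Algebra.ofId K _ x))
            = ((σ₀ : AlgebraicClosure K →ₐ[K] AlgebraicClosure K) :
                AlgebraicClosure K →+* AlgebraicClosure K) (C.toX (Algebra.ofId K _ x)) := rfl
          _ = (C.map ((σ₀ : AlgebraicClosure K →ₐ[K] AlgebraicClosure K) :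
                AlgebraicClosure K →+* AlgebraicClosure K)).toX (Algebra.ofId K _ x) := by
            rw [map_toX_ringHom]
            exact congrArg _ hσx
          _ = C.toX (Algebra.ofId K _ x) := by rw [hσ₀, toX_mul, hAX]
      · calc (σ₀ : AlgebraicClosure K →ₐ[K] AlgebraicClosure K)
              (C.toY (Algebra.ofId K _ x) (Algebra.ofId K _ y))
            = ((σ₀ : AlgebraicClosure K →ₐ[K] AlgebraicClosure K) :
                AlgebraicClosure K →+* AlgebraicClosure K)
                (C.toY (Algebra.ofId K _ x) (Algebra.ofId K _ y)) := rfl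
          _ = (C.map ((σ₀ : AlgebraicClosure K →ₐ[K] AlgebraicClosure K) :
                AlgebraicClosure K →+* AlgebraicClosure K)).toY (Algebra.ofId K _ x)
                (Algebra.ofId K _ y) := by
            rw [map_toY_ringHom]
            exact congrArg₂ _ hσx hσy
          _ = C.toY (Algebra.ofId K _ x) (Algebra.ofId K (AlgebraicClosure K) (E.toAffine.negY x y)) := by
            rw [hσ₀, toY_mul, hAX, hAY]
  -- the same map read in the `Γ_K`-module `E_q(K̄) = geomPoints (tateCurve q)`
  let Ψ : E.toAffine.Point →+ geomPoints (tateCurve q) := Φ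
  have hΨinj : Function.Injective Ψ := hΦinj
  have hnegΨ : ∀ P : E.toAffine.Point,
      ((absoluteGaloisGroup.toAlgEquiv K).symm σ₀) • Ψ P = -Ψ P := fun P => hneg P
  -- (5) Tate's uniformisation `φ : K̄^* ↠ E_q(K̄)`, kernel `q^ℤ`, `G_K`-equivariant (ATAEC V.3.1 (c)(d))
  obtain ⟨φ, hsurj, hker, hequiv, -⟩ := uniformization_holds q hq0 hq
  -- the spectral norm on `K̄`: multiplicative, extends `‖·‖`, Galois invariant
  letI : NontriviallyNormedField (AlgebraicClosure K) :=
    spectralNorm.nontriviallyNormedField K (AlgebraicClosure K)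
  have hnK : ∀ k : K, ‖algebraMap K (AlgebraicClosure K) k‖ = ‖k‖ := fun k => spectralNorm_extends k
  have hnσ : ∀ (σ : AlgebraicClosure K ≃ₐ[K] AlgebraicClosure K) (z : AlgebraicClosure K),
      ‖σ z‖ = ‖z‖ := fun σ z => (spectralNorm_eq_of_equiv σ z).symm
  set qb : AlgebraicClosure K := algebraMap K (AlgebraicClosure K) q with hqb
  have hqb0 : qb ≠ 0 := (map_ne_zero _).mpr hq0
  have hnq : ‖qb‖ = ‖q‖ := hnK q
  have hr0 : 0 < ‖q‖ := norm_pos_iff.mpr hq0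
  have hr1 : ‖q‖ ≠ 1 := hq.ne
  have hnodd : Odd (n : ℤ) := (Int.odd_coe_nat n).mpr hn
  -- (6) every `P ∈ S` is `φ(w)` for an `n`-th root of unity `w`
  have key : ∀ P ∈ S, ∃ w : (AlgebraicClosure K)ˣ,
      φ (Additive.ofMul w) = Ψ P ∧ (w : AlgebraicClosure K) ^ n = 1 := by
    intro P hP
    obtain ⟨a, ha⟩ := hsurj (Ψ P)
    set u : (AlgebraicClosure K)ˣ := Additive.toMul a with hu_def
    have hu : φ (Additive.ofMul u) = Ψ P := by simpa [hu_def] using ha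
    have hnP : n • Ψ P = 0 := by rw [← map_nsmul, hS P hP, map_zero]
    -- `uⁿ ∈ q^ℤ`
    have hun : φ (Additive.ofMul (u ^ n)) = 0 := by rw [ofMul_pow, map_nsmul, hu, hnP]
    obtain ⟨k, hk⟩ := (hker (u ^ n)).mp hun
    rw [Units.val_pow_eq_pow_val] at hk
    -- `σ₀(u) · u ∈ q^ℤ`
    have hσu := hequiv ((absoluteGaloisGroup.toAlgEquiv K).symm σ₀) u
    rw [MulEquiv.apply_symm_apply, hu, hnegΨ P] at hσu
    obtain ⟨uσ, hφσ, hσval⟩ : ∃ uσ : (AlgebraicClosure K)ˣ,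
        φ (Additive.ofMul uσ) = -Ψ P ∧ (uσ : AlgebraicClosure K) = σ₀ (u : AlgebraicClosure K) :=
      ⟨_, hσu.symm, by simp⟩
    have hprod : φ (Additive.ofMul (uσ * u)) = 0 := by
      rw [ofMul_mul, map_add, hφσ, hu, neg_add_cancel]
    obtain ⟨m, hm⟩ := (hker (uσ * u)).mp hprod
    rw [Units.val_mul, hσval] at hm
    -- norms: `‖u‖² = ‖q‖^m`, `‖u‖ⁿ = ‖q‖^k`, hence `m n = 2 k`, so `m` is even
    have h1 : ‖(u : AlgebraicClosure K)‖ * ‖(u : AlgebraicClosure K)‖ = ‖q‖ ^ m := by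
      have := congrArg (fun z : AlgebraicClosure K => ‖z‖) hm
      simpa only [norm_mul, hnσ, norm_zpow, hnq] using this
    have h2 : ‖(u : AlgebraicClosure K)‖ ^ n = ‖q‖ ^ k := by
      have := congrArg (fun z : AlgebraicClosure K => ‖z‖) hk
      simpa only [norm_pow, norm_zpow, hnq] using this
    have h3 : ‖q‖ ^ (m * (n : ℤ)) = ‖q‖ ^ (k + k) := by
      rw [zpow_mul, ← h1, zpow_natCast, mul_pow, h2, ← zpow_add₀ hr0.ne']
    have hmn : m * (n : ℤ) = k + k := zpow_right_injective₀ hr0 hr1 h3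
    have hmeven : Even m := by
      have hev : Even (m * (n : ℤ)) := ⟨k, hmn⟩
      rcases Int.even_mul.mp hev with h | h
      · exact h
      · exact absurd h (Int.not_even_iff_odd.mpr hnodd)
    obtain ⟨m', hm'⟩ := hmeven
    -- renormalise: `w := u · q^{-m'}` has `‖w‖ = 1` and the same image
    set Q : (AlgebraicClosure K)ˣ := Units.mk0 qb hqb0 with hQ
    have hQker : ∀ t : ℤ, φ (Additive.ofMul (Q ^ t)) = 0 := fun t =>
      (hker (Q ^ t)).mpr ⟨t, by simp [hQ, hqb]⟩
    set w : (AlgebraicClosure K)ˣ := u * Q ^ (-m') with hw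
    have hwφ : φ (Additive.ofMul w) = Ψ P := by
      rw [hw, ofMul_mul, map_add, hu, hQker, add_zero]
    have hwval : (w : AlgebraicClosure K) = (u : AlgebraicClosure K) * qb ^ (-m') := by
      simp [hw, hQ]
    have hwnorm : ‖(w : AlgebraicClosure K)‖ = 1 := by
      have hsq : ‖(w : AlgebraicClosure K)‖ * ‖(w : AlgebraicClosure K)‖ = 1 := by
        rw [hwval, norm_mul, norm_zpow, hnq, mul_mul_mul_comm, h1, hm', ← zpow_add₀ hr0.ne',
          ← zpow_add₀ hr0.ne']
        ring_nf
        simp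
      have hnn : 0 ≤ ‖(w : AlgebraicClosure K)‖ := norm_nonneg _
      nlinarith [hsq, hnn, sq_nonneg (‖(w : AlgebraicClosure K)‖ - 1)]
    -- `wⁿ ∈ q^ℤ` with `‖wⁿ‖ = 1`, hence `wⁿ = 1`
    have hwn : φ (Additive.ofMul (w ^ n)) = 0 := by rw [ofMul_pow, map_nsmul, hwφ, hnP]
    obtain ⟨k', hk'⟩ := (hker (w ^ n)).mp hwn
    rw [Units.val_pow_eq_pow_val] at hk'
    have hk'0 : k' = 0 := by
      have := congrArg (fun z : AlgebraicClosure K => ‖z‖) hk'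
      simp only [norm_pow, hwnorm, one_pow, norm_zpow, hnq] at this
      have h' : ‖q‖ ^ (0 : ℤ) = ‖q‖ ^ k' := by rw [zpow_zero]; exact this
      exact (zpow_right_injective₀ hr0 hr1 h').symm
    refine ⟨w, hwφ, ?_⟩
    rw [hk', hk'0, zpow_zero]
  -- (7) count: `P ↦ w_P` injects `S` into the `n`-th roots of unity of `K̄`
  choose! w hwφ hwn using key
  have hmaps : ∀ P ∈ S, (w P : AlgebraicClosure K) ∈ Polynomial.nthRootsFinset n (1 : AlgebraicClosure K) :=
    fun P hP => (Polynomial.mem_nthRootsFinset hn0 (1 : AlgebraicClosure K)).mpr (hwn P hP)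
  have hinj : Set.InjOn (fun P => (w P : AlgebraicClosure K)) S := by
    intro P hP P' hP' h
    have h' : w P = w P' := Units.ext h
    exact hΨinj (by rw [← hwφ P hP, ← hwφ P' hP', h'])
  have hle : S.card ≤ (Polynomial.nthRootsFinset n (1 : AlgebraicClosure K)).card :=
    Finset.card_le_card_of_injOn _ hmaps hinj
  have hroots : (Polynomial.nthRootsFinset n (1 : AlgebraicClosure K)).card ≤ n := by
    rw [Polynomial.nthRootsFinset_def]
    exact (Multiset.toFinset_card_le _).trans (Polynomial.card_nthRoots n _)
  omega

/-- **Corollary (the reduction type): more than `n` rational points killed by an odd `n` at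
`|j| > 1` force SPLIT multiplicative reduction** — some `K`-model of `E` (namely `E_q`) is a
minimal Weierstrass equation over the valuation ring `R` of `K` (`‖x‖ ≤ 1 ↔ x ∈ R`) with split
multiplicative reduction in Mathlib's sense (ATAEC Thm. V.5.3 (b) (i) ⇒ (iii), the tree's
`splitMultiplicative_of_iso_tateCurve`). [cite: SilvermanATAEC1994, Thm. V.5.3 (b) (PDF pp. 407–409)] -/
theorem hasSplitMultiplicativeReduction_of_odd_torsion (R : Type u) [CommRing R] [IsDomain R]
    [IsDiscreteValuationRing R] [Algebra R K] [IsFractionRing R K]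
    (hR : ∀ x : K, ‖x‖ ≤ 1 ↔ x ∈ Set.range (algebraMap R K)) (E : WeierstrassCurve K)
    [E.IsElliptic] {q : K} (hj : 1 < ‖E.j‖) (hq0 : q ≠ 0) (hq : ‖q‖ < 1) (hqj : tateJ q = E.j)
    {n : ℕ} (hn : Odd n) (S : Finset E.toAffine.Point) (hS : ∀ P ∈ S, n • P = 0)
    (hcard : n < S.card) :
    ∃ C : VariableChange K, (C • E).HasSplitMultiplicativeReduction R :=
  splitMultiplicative_of_iso_tateCurve R hR hq (iso_tateCurve_of_odd_torsion E hj hq0 hq hqj hn S hS hcard)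

/-- **Corollary (`γ`): under the same hypotheses `γ(E/K) = -c₄/c₆ ∈ K^{*2}`** (ATAEC V.5.3 (b)
(i) ⇒ (ii), the tree's `isSquare_gamma_of_iso_tateCurve`).
[cite: SilvermanATAEC1994, Thm. V.5.3 (b) (PDF pp. 407–409)] -/
theorem isSquare_gamma_of_odd_torsion (E : WeierstrassCurve K) [E.IsElliptic] {q : K}
    (hj : 1 < ‖E.j‖) (hq0 : q ≠ 0) (hq : ‖q‖ < 1) (hqj : tateJ q = E.j) {n : ℕ} (hn : Odd n)
    (S : Finset E.toAffine.Point) (hS : ∀ P ∈ S, n • P = 0) (hcard : n < S.card) :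
    IsSquare (-(E.c₄ / E.c₆)) :=
  isSquare_gamma_of_iso_tateCurve hq (by norm_num)
    (iso_tateCurve_of_odd_torsion E hj hq0 hq hqj hn S hS hcard)

end Local

/-! ### At a finite place of a number field -/

section NumberField

open IsDedekindDomain NumberField

variable (F : Type) [Field F] [NumberField F] (v : HeightOneSpectrum (𝓞 F))

/-- **A number-field curve `F_v`-isomorphic to a Tate curve has split multiplicative reduction at
`v`** in the tree's sense `WeierstrassCurve.HasSplitMultiplicativeReductionAt` (the CHOSEN local
minimal model at `v` has split multiplicative reduction): `E_q` is a minimal equation with split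
multiplicative reduction (the tree's `tateCurve_isMinimal`, `tateCurve_hasSplitMultiplicativeReduction`),
the chosen minimal model is `F_v`-isomorphic to it, and the reduction type of minimal models is an
isomorphism invariant (Silverman AEC VII.1.3 (b) / VII.5.1, the tree's
`hasSplitMultiplicativeReduction_iff_of_isMinimal_of_eq_smul`).
[cite: SilvermanATAEC1994, Thm. V.5.3 (b) (PDF pp. 407–409)]
[cite: SilvermanAEC2009, VII.1 Prop. 1.3(b) and VII.5 Prop. 5.1] -/
theorem hasSplitMultiplicativeReductionAt_of_iso_tateCurve (W : WeierstrassCurve F) [W.IsElliptic]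
    {q : v.adicCompletion F} (hq : ‖q‖ < 1) {C : VariableChange (v.adicCompletion F)}
    (hC : C • W.baseChange (v.adicCompletion F) = tateCurve q) :
    W.HasSplitMultiplicativeReductionAt v := by
  letI := Literature.NumberTheory.GaloisRepresentations.Ultrametric.AdicCompletion.nontriviallyNormedField F v
  haveI := charZero_adicCompletion' F v
  have hR := norm_le_one_iff_mem_range_adicCompletionIntegers F v
  haveI : (W.baseChange (v.adicCompletion F)).IsElliptic :=
    inferInstanceAs (W.map (algebraMap F (v.adicCompletion F))).IsElliptic
  haveI hTell : (tateCurve q).IsElliptic := hC ▸ inferInstance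
  haveI hTmin : (tateCurve q).IsMinimal (v.adicCompletionIntegers F) :=
    tateCurve_isMinimal (v.adicCompletionIntegers F) hR hq
  have hTsplit : (tateCurve q).HasSplitMultiplicativeReduction (v.adicCompletionIntegers F) :=
    tateCurve_hasSplitMultiplicativeReduction (v.adicCompletionIntegers F) hR hq
  -- the chosen local minimal model is `D • E_q` for a change of variables `D` over `F_v`
  obtain ⟨D, hD⟩ : ∃ D : VariableChange (v.adicCompletion F),
      W.localMinimalModel v = D • tateCurve q := by
    obtain ⟨E₁, hE₁⟩ : ∃ E₁ : VariableChange (v.adicCompletion F),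
        W.localMinimalModel v = E₁ • W.baseChange (v.adicCompletion F) := ⟨_, rfl⟩
    exact ⟨E₁ * C⁻¹, by rw [hE₁, mul_smul, ← hC, inv_smul_smul]⟩
  change (W.localMinimalModel v).HasSplitMultiplicativeReduction (v.adicCompletionIntegers F)
  exact (hasSplitMultiplicativeReduction_iff_of_isMinimal_of_eq_smul (v.adicCompletionIntegers F)
    hD (tateCurve q).isUnit_Δ.ne_zero).mpr hTsplit

/-- **Split multiplicative reduction from rational points of odd order, number-field form.**
`W/F` an elliptic curve over a number field, `v` a finite place with `|j(W)|_v > 1` (potentially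
multiplicative reduction at `v`), `n` ODD, and more than `n` points of `W(F_v)` killed by `n`
⟹ `W` has SPLIT multiplicative reduction at `v`. (Silverman ATAEC Thm. V.5.3 / Cor. V.5.4 at
`K = F_v`: the Tate parameter `q_v` of V.5.3 (a), then `iso_tateCurve_of_odd_torsion` and
`hasSplitMultiplicativeReductionAt_of_iso_tateCurve`.)
[cite: SilvermanATAEC1994, Thm. V.5.3 and Cor. V.5.4 (PDF pp. 407–410)] -/
theorem hasSplitMultiplicativeReductionAt_of_odd_torsion (W : WeierstrassCurve F) [W.IsElliptic]
    (hj : 1 < ‖algebraMap F (v.adicCompletion F) W.j‖) {n : ℕ} (hn : Odd n)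
    (S : Finset (W.baseChange (v.adicCompletion F)).toAffine.Point) (hS : ∀ P ∈ S, n • P = 0)
    (hcard : n < S.card) : W.HasSplitMultiplicativeReductionAt v := by
  letI := Literature.NumberTheory.GaloisRepresentations.Ultrametric.AdicCompletion.nontriviallyNormedField F v
  haveI := charZero_adicCompletion' F v
  haveI : (W.baseChange (v.adicCompletion F)).IsElliptic :=
    inferInstanceAs (W.map (algebraMap F (v.adicCompletion F))).IsElliptic
  have hj' : 1 < ‖(W.baseChange (v.adicCompletion F)).j‖ := by
    rw [show (W.baseChange (v.adicCompletion F)).j = algebraMap F (v.adicCompletion F) W.j from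
      W.map_j _]
    exact hj
  obtain ⟨q, hq0, hq, hqj, -⟩ :=
    isomorphic_tateCurve_of_one_lt_norm_j_holds (W.baseChange (v.adicCompletion F)) hj'
  obtain ⟨C, hC⟩ :=
    iso_tateCurve_of_odd_torsion (W.baseChange (v.adicCompletion F)) hj' hq0 hq hqj hn S hS hcard
  exact hasSplitMultiplicativeReductionAt_of_iso_tateCurve F v W hq hC

/-- The same with the hypothesis in valuation form, `1 < v.valuation F W.j` (i.e. `ord_v j(W) < 0`,
Mathlib's multiplicative `v`-adic valuation), the shape produced by the tree's
`one_lt_valuation_j_of_hasMultiplicativeReduction_localMinimalModel` /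
`one_lt_valuation_j_baseChange_of_hasMultiplicativeReductionAt` at a place of multiplicative
reduction (Silverman AEC VII.5.1 (b)). [cite: SilvermanATAEC1994, Thm. V.5.3 and Cor. V.5.4 (PDF pp. 407–410)]
[cite: SilvermanAEC2009, VII.5 Prop. 5.1(b)] -/
theorem hasSplitMultiplicativeReductionAt_of_odd_torsion_of_one_lt_valuation (W : WeierstrassCurve F)
    [W.IsElliptic] (hj : 1 < v.valuation F W.j) {n : ℕ} (hn : Odd n)
    (S : Finset (W.baseChange (v.adicCompletion F)).toAffine.Point) (hS : ∀ P ∈ S, n • P = 0)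
    (hcard : n < S.card) : W.HasSplitMultiplicativeReductionAt v := by
  refine hasSplitMultiplicativeReductionAt_of_odd_torsion F v W ?_ hn S hS hcard
  rw [Valued.toNormedField.one_lt_norm_iff, valued_algebraMap_adicCompletion]
  exact hj

end NumberField

end Literature.NumberTheory.EllipticCurves.TateCurve

end
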